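import Summits.Ventures.HSemireg.WedgeBasisFree
import Summits.Ventures.HSemireg.WedgeC15
import Summits.Ventures.HSemireg.WedgeHankelConfluent

/-!
# Venture HSemireg — THE FRAME CHANGE `x_a ↦ x_a + λ y_a`: an algebra automorphism of th-7's model carrying `w_n(q)` to `w_n(exp(λΘ)·q)`,
# hence every kernel / image / Siegel statement at the node `0` to the node `λ` — THE CONFLUENT KERNEL LAW AT EVERY NODE

HONEST FRAMING. Part of the Lean index of the computation cell `pub-hsemireg` (seat p10 gen 15, Sunday typer «UNIFORM-IN-n»).
Finite-dimensional EXTERIOR ALGEBRA over a field ONLY: no variety, no cohomology theory, no sheaf, no Ext group, no semiregularity map;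
nothing here says that HC / HC_CM / HC_AV holds; no Literature fact is declared or used.  Custodian versions as in `WedgeHankelSiegelIdeal`
(1/3) and `WedgeHankelConfluent`; FORMULA-N PART A §2.1–§2.2 / §2.6 (th-6: «the complex structure enters only through the frame»), PART B §N.8.
The dictionary (`v = Σ_j q_j Θ^j/j!` ↦ `w_n(q)`; `exp(λΘ)·v` ↦ the binomial transform `(expMul λ q)_j = Σ_i C(j,i) λ^{j−i} q_i`; the frame
`u^λ_a = x_a + λ y_a` of the exponential `exp(λΘ)`) is QUOTED, never asserted.

WHAT IS IN THE TREE / KEYED.  `WedgeBasisFree` (gen 6): a linear equivalence `g` of the generators induces the algebra isomorphism `mapEquiv g`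
of the exterior algebras, carrying `⋀^k` onto `⋀^k` and wedge kernels / images onto wedge kernels / images.  th-7's `WedgePairShear` (tree) and
gen 13's `WedgeHankelPureKernel` (row 732; `Ψ (shearEquiv λ)` via `CliffordAlgebra.equivOfIsometry`, `map_Ψ_Kr`, `Ψ(x_0 ∧ ⋯ ∧ x_{j−1}) = u_0 ∧ ⋯ ∧
u_{j−1}`) already use THIS shear to name the kernel of the PURE class `A·exp(λΘ)`.  THIS FILE re-derives the shear on gen 6's functorial `mapEquiv`
(so as to be PLAIN on tree files + E3, independent of 732; a bridge `Φs λ = Ψ (shearEquiv λ)` belongs to a file importing both and is NOT typed here)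
and makes the frame change GLOBAL — its action on EVERY class `w_m(q)`, on the Siegel ideal and on the confluent kernel law:
* §24 the SHEAR `shear λ : e_{x_a} ↦ e_{x_a} + λ e_{y_a}, e_{y_a} ↦ e_{y_a}` of the generators (a linear equivalence, inverse `shear (−λ)`) and the
  induced automorphism `Φs λ := mapEquiv (shear λ)` of `⋀(K^{2n})`: `Φs_X : Φs λ (x_a) = x_a + λ y_a`, `Φs_Y : Φs λ (y_a) = y_a`.
* §25 the BINOMIAL TRANSFORM `expMul λ q` (`(exp(λΘ)·v)`'s coefficients) with `shift (expMul λ q) = λ·expMul λ q + expMul λ (shift q)`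
  (`shift_expMul`, Pascal), and **`Φs_w`: `Φs λ (w_m(q)) = w_m(expMul λ q)` for every `m ≤ n` and every `q`** (th-7's recursion).
* §26 TRANSPORT: `Φs` preserves `⋀^k` = `Hom(univ, k)`; **`Kr_w_expMul`: `Kr(univ, w_n(expMul λ q), k) = Φs λ (Kr(univ, w_n(q), k))`** and
  `V_w_expMul` (images) for EVERY `q`, `k` — multiplying a class by `exp(λΘ)` moves its kernels and images by the frame change, ranks unchanged
  (`finrank_Kr_w_expMul`); the Siegel vectors are FIXED (`Φs_sv`), so **`map_Φs_siegelIdeal`: `Φs λ (SI_k) = SI_k`**.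
* §27 **THE CONFLUENT KERNEL LAW AT THE NODE `λ`: `Kr_w_expMul_of_order`: for `q` supported on `[0, P]` with `q_P ≠ 0` and `k + P ≤ n`,
  `Kr(univ, w_n(expMul λ q), k) = SI_k ⊔ Φs λ (xRich(k, P))`** — the class `exp(λΘ)·(polynomial of degree P)` (order `P + 1` at the node `λ`) has
  kernel the Siegel ideal plus the forms with more than `P` letters from the frame `{x_a + λ y_a}`; it depends only on `(λ, P)`
  (`Kr_w_expMul_eq_of_order`); `P = 0`: the pure class `A·exp(λΘ)` (`expMul_spike_zero`: `expMul λ (A δ_0) = (A λ^j)_j`) has kernel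
  `SI_k ⊔ Φs λ (xRich(k,0))` (`Kr_w_exp`) `= Φs λ (xRich(k, 0))` (**`Kr_w_exp_eq`**: exactly the forms generated by the frame `{x_a + λ y_a}` —
  gen 13's frame ideal `F_λ(k)`, recovered).
NOT typed here: several nodes (the divisor `Σ_i (P_i + 1)[λ_i]` — needs the intersection behaviour of the translated `xRich` spaces); the node at `∞`
combined with finite nodes; anything Ext-side.  Class side only.  Namespace `Summit.Ventures.HSemireg.Wedge.HankelFrameChange` (new); new names only.
-/

open Module

namespace Summit.Ventures.HSemireg.Wedge.HankelFrameChange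

open Summit.Ventures.HSemireg.Wedge Summit.Ventures.HSemireg.Wedge.Kunneth Summit.Ventures.HSemireg.Wedge.Hankel
  Summit.Ventures.HSemireg.Wedge.BasisFree Summit.Ventures.HSemireg.Wedge.HankelSiegel Summit.Ventures.HSemireg.Wedge.HankelSiegelIdeal
  Summit.Ventures.HSemireg.Wedge.KunnethKernel

variable (K : Type*) [Field K] {n : ℕ}

/-! ## §24. The shear of the generators and the induced automorphism -/

/-- the `x`-partner index of a `y`-index: for `i ≥ n`, the index `i − n`. -/
def xOf (i : In n) (h : n ≤ (i : ℕ)) : In n := ⟨i - n, by have := i.2; omega⟩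

/-- **THE SHEAR** `shearLin λ`: on coefficient vectors, `(g v)(y_a) = v(y_a) + λ·v(x_a)`, `(g v)(x_a) = v(x_a)` — i.e. `e_{x_a} ↦ e_{x_a} + λ e_{y_a}`,
`e_{y_a} ↦ e_{y_a}` on the standard basis. -/
noncomputable def shearLin (lam : K) : (In n → K) →ₗ[K] (In n → K) where
  toFun v i := v i + if h : n ≤ (i : ℕ) then lam * v (xOf i h) else 0
  map_add' v v' := by
    funext i
    simp only [Pi.add_apply]
    split_ifs <;> ring
  map_smul' c v := by
    funext i
    simp only [Pi.smul_apply, smul_eq_mul, RingHom.id_apply]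
    split_ifs <;> ring

/-- the shear, pointwise. -/
lemma shearLin_apply (lam : K) (v : In n → K) (i : In n) :
    shearLin K lam v i = v i + if h : n ≤ (i : ℕ) then lam * v (xOf i h) else 0 := rfl

omit [Field K] in
/-- the `x`-partner of a `y`-index is an `x`-index. -/
lemma xOf_lt (i : In n) (h : n ≤ (i : ℕ)) : ((xOf i h : In n) : ℕ) < n := by
  simp only [xOf]; have := i.2; omega

/-- `shear (−λ)` undoes `shear λ`. -/
lemma shearLin_neg_comp (lam : K) (v : In n → K) : shearLin K (-lam) (shearLin K lam v) = v := by
  funext i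
  rw [shearLin_apply, shearLin_apply]
  by_cases h : n ≤ (i : ℕ)
  · have h' : ¬ n ≤ ((xOf i h : In n) : ℕ) := by have := xOf_lt i h; omega
    rw [dif_pos h, dif_pos h, shearLin_apply, dif_neg h']
    ring
  · rw [dif_neg h, dif_neg h, add_zero, add_zero]

/-- **the shear as a linear equivalence** (inverse: the shear by `−λ`). -/
noncomputable def shear (lam : K) : (In n → K) ≃ₗ[K] (In n → K) where
  toLinearMap := shearLin K lam
  invFun := shearLin K (-lam)
  left_inv v := shearLin_neg_comp K lam v
  right_inv v := by simpa using shearLin_neg_comp K (-lam) v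

/-- values of the standard basis vectors: `e_j(i) = [i = j]`. -/
lemma b_apply' (j i : In n) : b K (In n) j i = if i = j then 1 else 0 := by
  rw [b, Pi.basisFun_apply, Pi.single_apply]

omit [Field K] in
/-- the `x`-partner of `i` is `x_a` iff `i = y_a`. -/
lemma xOf_eq_castAdd_iff (i : In n) (h : n ≤ (i : ℕ)) (a : Fin n) : xOf i h = Fin.castAdd n a ↔ i = Fin.natAdd n a := by
  simp only [xOf, Fin.ext_iff, Fin.val_castAdd, Fin.val_natAdd]
  omega

omit [Field K] in
/-- a `y`-index is not an `x`-index. -/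
lemma ne_castAdd_of_le {i : In n} (h : n ≤ (i : ℕ)) (a : Fin n) : i ≠ Fin.castAdd n a := by
  intro e; rw [Fin.ext_iff, Fin.val_castAdd] at e; have := a.2; omega

omit [Field K] in
/-- an `x`-index is not a `y`-index. -/
lemma ne_natAdd_of_lt {i : In n} (h : ¬ n ≤ (i : ℕ)) (a : Fin n) : i ≠ Fin.natAdd n a := by
  intro e; rw [Fin.ext_iff, Fin.val_natAdd] at e; omega

/-- the shear on the basis vector `e_{x_a}`: `e_{x_a} + λ e_{y_a}`. -/
lemma shear_b_castAdd (lam : K) (a : Fin n) :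
    shear K lam (b K (In n) (Fin.castAdd n a)) = b K (In n) (Fin.castAdd n a) + lam • b K (In n) (Fin.natAdd n a) := by
  funext i
  show shearLin K lam _ i = _
  rw [shearLin_apply, Pi.add_apply, Pi.smul_apply, smul_eq_mul]
  by_cases h : n ≤ (i : ℕ)
  · have e1 : b K (In n) (Fin.castAdd n a) (xOf i h) = b K (In n) (Fin.natAdd n a) i := by
      rw [b_apply', b_apply']
      by_cases h2 : i = Fin.natAdd n a
      · rw [if_pos h2, if_pos ((xOf_eq_castAdd_iff i h a).mpr h2)]
      · rw [if_neg h2, if_neg (fun e => h2 ((xOf_eq_castAdd_iff i h a).mp e))]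
    rw [dif_pos h, e1]
  · have e2 : b K (In n) (Fin.natAdd n a) i = 0 := by rw [b_apply', if_neg (ne_natAdd_of_lt h a)]
    rw [dif_neg h, e2, mul_zero]

/-- the shear fixes the basis vector `e_{y_a}`. -/
lemma shear_b_natAdd (lam : K) (a : Fin n) : shear K lam (b K (In n) (Fin.natAdd n a)) = b K (In n) (Fin.natAdd n a) := by
  funext i
  show shearLin K lam _ i = _
  rw [shearLin_apply]
  by_cases h : n ≤ (i : ℕ)
  · have e1 : b K (In n) (Fin.natAdd n a) (xOf i h) = 0 := by
      rw [b_apply', if_neg]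
      intro e; rw [Fin.ext_iff, Fin.val_natAdd] at e; have := xOf_lt i h; omega
    rw [dif_pos h, e1, mul_zero, add_zero]
  · rw [dif_neg h, add_zero]

/-- **THE FRAME-CHANGE AUTOMORPHISM `Φs λ := mapEquiv (shear λ)`** of `⋀(K^{2n})`. -/
noncomputable def Φs (lam : K) : HT K (In n) ≃ₐ[K] HT K (In n) := mapEquiv K (shear K (n := n) lam)

/-- `Φs λ (ι v) = ι (shear λ v)`. -/
lemma Φs_ι (lam : K) (v : In n → K) : Φs K lam (ExteriorAlgebra.ι K v) = ExteriorAlgebra.ι K (shear K lam v) := by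
  rw [Φs, mapEquiv_apply, ExteriorAlgebra.map_apply_ι]; rfl

/-- **`Φs λ (x_a) = x_a + λ y_a`** (the frame vector `u^λ_a`). -/
theorem Φs_X (lam : K) (a : Fin n) : Φs K lam (X K n a) = X K n a + lam • Y K n a := by
  rw [X_fin, Φs_ι, shear_b_castAdd, map_add, map_smul, ← X_fin, ← Y_fin]

/-- **`Φs λ (y_a) = y_a`.** -/
theorem Φs_Y (lam : K) (a : Fin n) : Φs K lam (Y K n a) = Y K n a := by
  rw [Y_fin, Φs_ι, shear_b_natAdd]

/-! ## §25. The binomial transform `exp(λΘ)·v` and the transport of th-7's class -/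

/-- **THE BINOMIAL TRANSFORM** `expMul λ q` — the coefficient sequence of `exp(λΘ)·v` for `v = Σ_j q_j Θ^j/j!` (dictionary quoted) — defined by
the Pascal recursion `(expMul λ q)_0 = q_0`, `(expMul λ q)_{j+1} = λ·(expMul λ q)_j + (expMul λ (σq))_j`; closed form `Σ_{i ≤ j} C(j,i) λ^{j−i} q_i`
(`expMul_eq_sum`). -/
def expMul (lam : K) : (ℕ → K) → ℕ → K
  | q, 0 => q 0
  | q, j + 1 => lam * expMul lam q j + expMul lam (shift K q) j

/-- `(expMul λ q)_0 = q_0`. -/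
@[simp] lemma expMul_zero (lam : K) (q : ℕ → K) : expMul K lam q 0 = q 0 := rfl

/-- the Pascal recursion `(expMul λ q)_{j+1} = λ·(expMul λ q)_j + (expMul λ (σq))_j`. -/
lemma expMul_succ (lam : K) (q : ℕ → K) (j : ℕ) : expMul K lam q (j + 1) = lam * expMul K lam q j + expMul K lam (shift K q) j := rfl

/-- **`shift (expMul λ q) = λ·(expMul λ q) + expMul λ (shift q)`** pointwise. -/
theorem shift_expMul (lam : K) (q : ℕ → K) (j : ℕ) :
    shift K (expMul K lam q) j = lam * expMul K lam q j + expMul K lam (shift K q) j := rfl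

/-- `expMul` is additive in the sequence. -/
lemma expMul_add (lam : K) (q q' : ℕ → K) (j : ℕ) : expMul K lam (fun i => q i + q' i) j = expMul K lam q j + expMul K lam q' j := by
  induction j generalizing q q' with
  | zero => rfl
  | succ j ih =>
    have hs : shift K (fun i => q i + q' i) = fun i => shift K q i + shift K q' i := rfl
    rw [expMul_succ, expMul_succ, expMul_succ, hs, ih, ih]; ring

/-- `expMul` is homogeneous in the sequence. -/
lemma expMul_smul (lam c : K) (q : ℕ → K) (j : ℕ) : expMul K lam (fun i => c * q i) j = c * expMul K lam q j := by
  induction j generalizing q with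
  | zero => rfl
  | succ j ih =>
    have hs : shift K (fun i => c * q i) = fun i => c * shift K q i := rfl
    rw [expMul_succ, expMul_succ, hs, ih, ih]; ring

/-- **THE CLOSED FORM `(expMul λ q)_j = Σ_{i ≤ j} C(j,i) λ^{j−i} q_i`** (Pascal's rule). -/
theorem expMul_eq_sum (lam : K) (q : ℕ → K) (j : ℕ) :
    expMul K lam q j = ∑ i ∈ Finset.range (j + 1), (j.choose i : K) * lam ^ (j - i) * q i := by
  induction j generalizing q with
  | zero => simp
  | succ j ih =>
    rw [expMul_succ, ih, ih, Finset.sum_range_succ' _ (j + 1)]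
    -- Pascal on the shifted terms of the right-hand side
    have h1 : ∀ i ∈ Finset.range (j + 1), ((j + 1).choose (i + 1) : K) * lam ^ (j + 1 - (i + 1)) * q (i + 1) =
        (j.choose i : K) * lam ^ (j - i) * shift K q i + (j.choose (i + 1) : K) * lam ^ (j - i) * q (i + 1) := by
      intro i _
      rw [Nat.choose_succ_succ', Nat.cast_add, show j + 1 - (i + 1) = j - i by omega, shift_apply]; ring
    rw [Finset.sum_congr rfl h1, Finset.sum_add_distrib, Nat.choose_zero_right, Nat.cast_one, one_mul, Nat.sub_zero]
    -- the λ-part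
    have h2 : lam * ∑ i ∈ Finset.range (j + 1), (j.choose i : K) * lam ^ (j - i) * q i =
        ∑ i ∈ Finset.range (j + 1), (j.choose (i + 1) : K) * lam ^ (j - i) * q (i + 1) + lam ^ (j + 1) * q 0 := by
      rw [Finset.sum_range_succ' _ j, Finset.sum_range_succ _ j, Nat.choose_succ_self, Nat.cast_zero, zero_mul, zero_mul,
        add_zero, Nat.choose_zero_right, Nat.cast_one, one_mul, Nat.sub_zero, mul_add, Finset.mul_sum, pow_succ]
      congr 1
      · refine Finset.sum_congr rfl fun i hi => ?_
        rw [Finset.mem_range] at hi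
        rw [show j - i = (j - (i + 1)) + 1 by omega, pow_succ]; ring
      · ring
    rw [h2]; ring

/-- **`Φs λ (w_m(q)) = w_m(expMul λ q)` for every `m ≤ n` and every `q`**: the frame change multiplies the class by `exp(λΘ)` (th-7's recursion
`w_{m+1}(q) = w_m(q) x_m + w_m(σq) y_m`, `σ(expMul λ q) = λ·expMul λ q + expMul λ (σq)`). -/
theorem Φs_w (lam : K) {m : ℕ} (hm : m ≤ n) (q : ℕ → K) : Φs K lam (w K n m q) = w K n m (expMul K lam q) := by
  induction m generalizing q with
  | zero => rw [w, w, map_smul, map_one, expMul_zero]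
  | succ m ih =>
    have hmn : m < n := by omega
    have hX : X K n m = X K n (⟨m, hmn⟩ : Fin n) := rfl
    have hY : Y K n m = Y K n (⟨m, hmn⟩ : Fin n) := rfl
    rw [w, w, map_add, map_mul, map_mul, ih (by omega), ih (by omega), hX, hY, Φs_X, Φs_Y]
    have hs : w K n m (shift K (expMul K lam q)) = lam • w K n m (expMul K lam q) + w K n m (expMul K lam (shift K q)) := by
      have e : shift K (expMul K lam q) = fun j => lam * expMul K lam q j + expMul K lam (shift K q) j := funext (shift_expMul K lam q)
      rw [e, w_add, w_smul]
    rw [hs, mul_add, add_mul, mul_smul_comm, smul_mul_assoc]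
    abel


/-- `Φs λ (X_c) = X_c + λ Y_c` in th-7's `ℕ`-indexed notation (both sides `0` for `c ≥ n`). -/
lemma Φs_X' (lam : K) (c : ℕ) : Φs K lam (X K n c) = X K n c + lam • Y K n c := by
  by_cases hc : c < n
  · exact Φs_X K lam ⟨c, hc⟩
  · rw [X, Y, dif_neg hc, dif_neg hc, map_zero, smul_zero, add_zero]

/-- `Φs λ (Y_c) = Y_c` in th-7's `ℕ`-indexed notation. -/
lemma Φs_Y' (lam : K) (c : ℕ) : Φs K lam (Y K n c) = Y K n c := by
  by_cases hc : c < n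
  · exact Φs_Y K lam ⟨c, hc⟩
  · rw [Y, dif_neg hc, map_zero]

/-! ## §26. Transport of kernels, images and the Siegel ideal -/

/-- `Φs λ` maps `⋀^k` onto `⋀^k`. -/
lemma map_Φs_exteriorPower (lam : K) (k : ℕ) :
    (⋀[K]^k (In n → K)).map (Φs K (n := n) lam).toLinearMap = ⋀[K]^k (In n → K) :=
  map_exteriorPower K _ k

/-- `Φs λ θ ∈ ⋀^k` for `θ ∈ ⋀^k`. -/
lemma Φs_mem_exteriorPower (lam : K) {k : ℕ} {θ : HT K (In n)} (hθ : θ ∈ ⋀[K]^k (In n → K)) :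
    Φs K lam θ ∈ ⋀[K]^k (In n → K) := by
  rw [← map_Φs_exteriorPower K lam k]; exact ⟨θ, hθ, rfl⟩

/-- **KERNELS ARE TRANSPORTED: `Kr(univ, Φs λ f, k) = Φs λ (Kr(univ, f, k))`** for every class `f` and degree `k`. -/
theorem Kr_Φs (lam : K) (f : HT K (In n)) (k : ℕ) :
    Kr K Finset.univ (Φs K lam f) k = (Kr K Finset.univ f k).map (Φs K (n := n) lam).toLinearMap := by
  ext θ
  rw [mem_Kr, Submodule.mem_map, KunnethKernel.Hom_univ_eq_exteriorPower]
  constructor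
  · rintro ⟨hθ, h0⟩
    have hθ' : θ ∈ (⋀[K]^k (In n → K)).map (Φs K (n := n) lam).toLinearMap := by rwa [map_Φs_exteriorPower]
    obtain ⟨θ', hθ', rfl⟩ := hθ'
    refine ⟨θ', mem_Kr.mpr ⟨by rwa [KunnethKernel.Hom_univ_eq_exteriorPower], ?_⟩, rfl⟩
    apply (Φs K (n := n) lam).injective
    rw [map_mul, map_zero]; exact h0
  · rintro ⟨θ', hθ', rfl⟩
    rw [mem_Kr, KunnethKernel.Hom_univ_eq_exteriorPower] at hθ'
    refine ⟨Φs_mem_exteriorPower K lam hθ'.1, ?_⟩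
    rw [AlgEquiv.toLinearMap_apply, ← map_mul, hθ'.2, map_zero]

/-- **IMAGES ARE TRANSPORTED: `V(univ, Φs λ f, k) = Φs λ (V(univ, f, k))`.** -/
theorem V_Φs (lam : K) (f : HT K (In n)) (k : ℕ) :
    V K (In n) Finset.univ (Φs K lam f) k = (V K (In n) Finset.univ f k).map (Φs K (n := n) lam).toLinearMap := by
  have hc : (Φs K (n := n) lam).toLinearMap ∘ₗ LinearMap.mulRight K f =
      LinearMap.mulRight K (Φs K lam f) ∘ₗ (Φs K (n := n) lam).toLinearMap := by
    ext θ; simp [map_mul]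
  rw [V_eq_map, V_eq_map, ← Submodule.map_comp, hc, Submodule.map_comp, KunnethKernel.Hom_univ_eq_exteriorPower,
    map_Φs_exteriorPower]

/-- **MULTIPLYING BY `exp(λΘ)` MOVES THE KERNELS BY THE FRAME CHANGE: `Kr(univ, w_n(expMul λ q), k) = Φs λ (Kr(univ, w_n(q), k))`** for every `q`, `k`. -/
theorem Kr_w_expMul (lam : K) (q : ℕ → K) (k : ℕ) :
    Kr K Finset.univ (w K n n (expMul K lam q)) k = (Kr K Finset.univ (w K n n q) k).map (Φs K (n := n) lam).toLinearMap := by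
  rw [← Φs_w K lam le_rfl, Kr_Φs]

/-- … and the images: `V(univ, w_n(expMul λ q), k) = Φs λ (V(univ, w_n(q), k))`. -/
theorem V_w_expMul (lam : K) (q : ℕ → K) (k : ℕ) :
    V K (In n) Finset.univ (w K n n (expMul K lam q)) k = (V K (In n) Finset.univ (w K n n q) k).map (Φs K (n := n) lam).toLinearMap := by
  rw [← Φs_w K lam le_rfl, V_Φs]

/-- hence the kernel NUMBERS of `v` and `exp(λΘ)·v` agree in every degree. -/
theorem finrank_Kr_w_expMul (lam : K) (q : ℕ → K) (k : ℕ) :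
    finrank K (Kr K Finset.univ (w K n n (expMul K lam q)) k) = finrank K (Kr K Finset.univ (w K n n q) k) := by
  rw [Kr_w_expMul]; exact (Φs K (n := n) lam).toLinearEquiv.finrank_map_eq _

/-- **THE SIEGEL VECTORS ARE FIXED: `Φs λ (s_{ab}) = s_{ab}`** (`(x_a + λy_a) y_b + (x_b + λy_b) y_a = s_{ab} + λ(y_a y_b + y_b y_a)`). -/
theorem Φs_sv (lam : K) (a c : ℕ) : Φs K lam (sv K (n := n) a c) = sv K a c := by
  rw [sv]
  by_cases hac : a = c
  · subst hac
    rw [if_pos rfl, add_zero, map_mul, Φs_X', Φs_Y', add_mul, smul_mul_assoc, mul_self_of_gen (Y_gen K a), smul_zero, add_zero]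
  · rw [if_neg hac, map_add, map_mul, map_mul, Φs_X', Φs_Y', Φs_X', Φs_Y', add_mul, add_mul, smul_mul_assoc, smul_mul_assoc,
      anticomm_of_gen (Y_gen K c) (Y_gen K a), smul_neg]
    abel

/-- the Siegel generators are fixed: `Φs λ (sgen p) = sgen p`. -/
lemma Φs_sgen (lam : K) (p : SIdx n) : Φs K lam (sgen K p) = sgen K p := Φs_sv K lam _ _

/-- `η ∧ s_{ab} ∈ SI_{j+2}` for every `η ∈ ⋀^j` (the Siegel ideal is an ideal). -/
lemma mul_sgen_mem_siegelIdeal {j : ℕ} {η : HT K (In n)} (hη : η ∈ ⋀[K]^j (In n → K)) (p : SIdx n) :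
    η * sgen K p ∈ siegelIdeal K n (j + 2) := by
  rw [exteriorPower_eq_span] at hη
  induction hη using Submodule.span_induction with
  | mem x hx =>
    obtain ⟨t, ht, rfl⟩ := hx
    exact Submodule.subset_span ⟨(⟨t, by rw [Set.mem_setOf_eq] at ht; omega⟩, p), rfl⟩
  | zero => rw [zero_mul]; exact Submodule.zero_mem _
  | add x y _ _ hx hy => rw [add_mul]; exact Submodule.add_mem _ hx hy
  | smul c x _ hx => rw [smul_mul_assoc]; exact Submodule.smul_mem _ _ hx

/-- **THE SIEGEL IDEAL IS INVARIANT: `Φs λ (SI_k) = SI_k`.** -/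
theorem map_Φs_siegelIdeal (lam : K) (k : ℕ) :
    (siegelIdeal K n k).map (Φs K (n := n) lam).toLinearMap = siegelIdeal K n k := by
  have hle : (siegelIdeal K n k).map (Φs K (n := n) lam).toLinearMap ≤ siegelIdeal K n k := by
    rw [siegelIdeal, Submodule.map_span, Submodule.span_le]
    rintro _ ⟨_, ⟨p, rfl⟩, rfl⟩
    obtain ⟨⟨t, ht⟩, s⟩ := p
    subst ht
    rw [SetLike.mem_coe, AlgEquiv.toLinearMap_apply, igen, map_mul, Φs_sgen]
    have hB : B K (In n) t ∈ ⋀[K]^t.card (In n → K) := by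
      rw [exteriorPower_eq_Hom_univ]; exact B_mem_Hom K (Finset.subset_univ t) rfl
    exact mul_sgen_mem_siegelIdeal K (Φs_mem_exteriorPower K lam hB) s
  exact Submodule.eq_of_le_of_finrank_eq hle ((Φs K (n := n) lam).toLinearEquiv.finrank_map_eq _)

/-! ## §27. The confluent kernel law at the node `λ` -/

/-- **THE CONFLUENT KERNEL LAW AT THE NODE `λ`**: for `q` supported on `[0, P]` with `q_P ≠ 0` and `k + P ≤ n`, the class `exp(λΘ)·v`
(`v = Σ_{p ≤ P} q_p Θ^p/p!`; an order-`(P+1)` node at `λ`) has **`Kr(univ, w_n(expMul λ q), k) = SI_k ⊔ Φs λ (xRich(k, P))`** — the Siegel ideal plus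
the forms with more than `P` letters from the frame `{x_a + λ y_a}`. -/
theorem Kr_w_expMul_of_order (lam : K) {k P : ℕ} (hkP : k + P ≤ n) {q : ℕ → K} (hq : ∀ j, P < j → q j = 0) (hqP : q P ≠ 0) :
    Kr K Finset.univ (w K n n (expMul K lam q)) k = siegelIdeal K n k ⊔ (xRich K n k P).map (Φs K (n := n) lam).toLinearMap := by
  rw [Kr_w_expMul, Kr_w_eq_of_order K hkP hq hqP, Submodule.map_sup, map_Φs_siegelIdeal]

/-- it depends only on `(λ, P)`: two classes of order `P` at `0` give, after multiplication by `exp(λΘ)`, the same kernels (`k ≤ n − P`). -/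
theorem Kr_w_expMul_eq_of_order (lam : K) {k P : ℕ} (hkP : k + P ≤ n) {q q' : ℕ → K} (hq : ∀ j, P < j → q j = 0) (hqP : q P ≠ 0)
    (hq' : ∀ j, P < j → q' j = 0) (hqP' : q' P ≠ 0) :
    Kr K Finset.univ (w K n n (expMul K lam q)) k = Kr K Finset.univ (w K n n (expMul K lam q')) k := by
  rw [Kr_w_expMul_of_order K lam hkP hq hqP, Kr_w_expMul_of_order K lam hkP hq' hqP']

/-- the order-`1` case is the pure class: **`expMul λ (A·δ_0) = (A λ^j)_j`**, the exponential `A·exp(λΘ)` (gen 13's `expSeq`, by value). -/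
theorem expMul_spike_zero (lam A : K) (j : ℕ) : expMul K lam (fun i => if i = 0 then A else 0) j = A * lam ^ j := by
  rw [expMul_eq_sum, Finset.sum_eq_single 0]
  · simp [mul_comm]
  · intro i _ hi; rw [if_neg hi, mul_zero]
  · intro h; exact absurd (Finset.mem_range.mpr (by omega)) h

/-- **THE PURE CLASS AT SLOPE `λ`**: `Kr(univ, w_n(A λ^•), k) = SI_k ⊔ Φs λ (xRich(k, 0))` for `A ≠ 0`, `k ≤ n` — the Siegel ideal plus every form with a
letter from the frame `{x_a + λ y_a}` (gen 13's frame ideal `F_λ(k)`, by value). -/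
theorem Kr_w_exp (lam : K) {k : ℕ} (hk : k ≤ n) {A : K} (hA : A ≠ 0) :
    Kr K Finset.univ (w K n n (fun j => A * lam ^ j)) k = siegelIdeal K n k ⊔ (xRich K n k 0).map (Φs K (n := n) lam).toLinearMap := by
  have e : (fun j => A * lam ^ j) = expMul K lam (fun i => if i = 0 then A else 0) := funext fun j => (expMul_spike_zero K lam A j).symm
  rw [e]
  exact Kr_w_expMul_of_order K lam (P := 0) (by omega) (fun j hj => if_neg (by omega)) (by rw [if_pos rfl]; exact hA)

/-- **… SHARP: `Kr(univ, w_n(A λ^•), k) = Φs λ (xRich(k, 0))`** (`A ≠ 0`, `k ≤ n`) — exactly the degree-`k` forms generated by the frame `{x_a + λ y_a}`: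
gen 13's frame ideal `F_λ(k)`, recovered from the confluent law and the frame change. -/
theorem Kr_w_exp_eq {k : ℕ} (hk : k ≤ n) (lam : K) {A : K} (hA : A ≠ 0) :
    Kr K Finset.univ (w K n n (fun j => A * lam ^ j)) k = (xRich K n k 0).map (Φs K (n := n) lam).toLinearMap := by
  have e : (fun j => A * lam ^ j) = expMul K lam (fun i => if i = 0 then A else 0) := funext fun j => (expMul_spike_zero K lam A j).symm
  rw [e, Kr_w_expMul, Kr_w_pure_zero K hk hA]

end Summit.Ventures.HSemireg.Wedge.HankelFrameChange
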